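import Literature.NumberTheory.EllipticCurves.OverconvergentModularSymbolsWeightTwo
import Literature.NumberTheory.EllipticCurves.PAdicLFunctionInterpolationHoldsProofs
import HarnessLib

/-!
# The critical-slope `p`-adic `L`-function `L_p(f_β, T)` of a weight-two newform
# (Pollack–Stevens), defined THROUGH the overconvergent eigen-lift `Φ_β`

Definition item `defn-CriticalSlopePAdicLFunction` (trunk `Literature/NumberTheory/EllipticCurves`;
wanted by route `SlopeDichotomyA2` of `BirchSwinnertonDyer`, cruxes `BetaGrossZagierA2` /
`BetaLeadingTermA2`).  Companion of `OverconvergentModularSymbolsWeightTwo` (the spaces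
`Symb_{Γ₀(Np)}(𝐃)`, the eigen-lift predicate `IsEigenLift W f β Φ`, the coset moments
`cosetMoments Φ β n a = (∫_{a + pⁿℤ_p} xʲ dμ_Φ)_j` of `μ_Φ = Φ({∞} − {0})` and their interpolation
property `charValue_eq_of_specializeFun_eq`).

## What is defined

Let `p` be a prime, `e₀ = cyclotomicExponent p` (`1` for odd `p`, `2` for `p = 2`),
`γ = 1 + p^{e₀} = cyclotomicGenerator p` the topological generator of `1 + p^{e₀}ℤ_p`, `μ_τ ⊂ ℤ_p^×`
the torsion (`τ = torsionOrder p`), so that every `x ∈ ℤ_p^×` is uniquely `x = η·⟨x⟩`, `η ∈ μ_τ`,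
`⟨x⟩ = γ^{ℓ(x)} ∈ 1 + p^{e₀}ℤ_p`, `ℓ(x) = log_γ⟨x⟩ = log_p(x/η)/log_p(γ)` — the tree's coordinates of
`PAdicLFunction.lean` (Mazur–Tate–Teitelbaum §I.13), in which the unit-root `p`-adic `L`-function is
`L_p(f, α, T) = ∫_{ℤ_p^×} (1 + T)^{ℓ(x)} dμ_{f,α}(x)` (`padicLFunction f α`).

For an overconvergent `U_p`-eigensymbol `Φ` with eigenvalue `β` (in the moment model of
`OverconvergentModularSymbolsWeightTwo`) we define, following [PollackStevens2011, §9.1–9.2]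
VERBATIM (their `w` is our `T`, their tame character `ψ` is trivial here):

* `mahlerLogCoeff p k j = c_j^{(k)}`, the Taylor coefficients of
  `binom(log_γ(1 + u), k) = ∑_j c_j^{(k)} uʲ` (PS §9.2: "`binom(log_γ(z·{a}⁻¹), n) = ∑_j c_j^{(n)} (z/{a} − 1)ʲ`
  for some elements `c_j^{(n)} ∈ ℚ_p`"), through the power series `logOnePlusSeries = log(1+u)`,
  the constant `logCyclotomicGenerator = log_p(γ)` and `mahlerLogSeries k = binom(log(1+u)/log_p(γ), k)`;
* `teichmullerShiftedMoment Φ β η j = ∫_{η + p^{e₀}ℤ_p} (x/η − 1)ʲ dμ_Φ(x)`, a finite combination of the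
  coset moments `cosetMoments Φ β e₀ (η mod p^{e₀})` (PS (5): "`{a}^{−j} ∫_{a+pℤ_p} (z − {a})ʲ dμ`");
* `criticalSlopePAdicLCoeff Φ β k = c_k = ∑_{η ∈ μ_τ} ∑_j c_j^{(k)} ∫_{η + p^{e₀}ℤ_p} (x/η − 1)ʲ dμ_Φ
  = ∫_{ℤ_p^×} binom(ℓ(x), k) dμ_Φ(x)` (PS §9.1: "the `n`-th coefficient of `L_p(μ, ψ, w)` is
  `∫_{ℤ_p^×} ψ(z) binom(log_γ⟨z⟩, n) dμ(z)`", and (5));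
* `criticalSlopePAdicLFunction Φ β = L_p(Φ, β; T) = ∑_k c_k T^k = ∫_{ℤ_p^×} (1 + T)^{ℓ(x)} dμ_Φ(x) ∈ ℚ_p⟦T⟧`
  (PS §9.1: "`L_p(μ, ψ, w) = ∫_{ℤ_p^×} ψ(z)·(w+1)^{log_γ⟨z⟩} dμ(z) = ∑_n (∫ ψ(z) binom(log_γ⟨z⟩, n) dμ) wⁿ`");
* `criticalSlopePAdicLFunctionOf W f β = L_p(f_β, T)`: the above for an eigen-lift `Φ_β` of the
  `p`-stabilised symbol `φ_β` of the newform `f` of `W` (`IsEigenLift W f β Φ_β`; existence is the named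
  fact `pollackStevens_criticalSlope_eigenLift`, uniqueness the theorem `IsEigenLift.unique` under the
  non-`θ`-criticality hypothesis `SpecializeInjOnEigenspace`), junk `0` if there is none
  (PS Def. 6.4: "the `p`-adic `L`-function of `f_β` is `μ_{f_β} := Φ_{f_β}({∞} − {0})|_{ℤ_p^×}`";
  [Bellaiche2012, §1.4.2]: "`L^±(f_β, σ) := Φ^±_{f_β}({∞} − {0})(σ)`").

So `L_p(f_β, T)` is defined THROUGH `Φ_β` — NOT as `padicLFunction f β` (whose Riemann sums of
values on compact opens converge only for a measure, i.e. for the unit root; for `v_p(β) = 1` the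
distribution `μ_{f_β}` is merely `1`-admissible and its values on opens, equivalently its interpolation
values, do NOT determine it: [PollackStevens2011, §6.4 (p. 31)]).  The series over `j` converge because
`a ≡ {a} (mod p^{e₀})` makes the shifted moments `O(p^{−e₀ j})` while `c_j^{(k)}` grows polynomially
(PS §9.2: "`p^{j − ord_p(λ)}` divides `∫_{a+pℤ_p}(z − {a})ʲ dμ` … the constants `c_j^{(n)}` are
independent of `Φ`, and their `p`-adic valuations are easily computed") — PROVED here
(`summable_mahlerLogCoeff_mul_teichmullerShiftedMoment`, `hasSum_criticalSlopePAdicLCoeff`).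

## Proved API (no named facts are introduced; net debt delta 0)

* `teichmullerShiftedMoment_eq_sum` — PS's computation (§9.2, display after (5)):
  `∫_{η+p^{e₀}ℤ_p}(x/η − 1)ʲ dμ_Φ = β^{−e₀} ∑_{m ≤ j} (j choose m)(a/η − 1)^{j−m}(p^{e₀}/η)ᵐ Φ(D_a)(zᵐ)`;
* `norm_teichmullerShiftedMoment_le` (`O(p^{−e₀ j})`), `norm_mahlerLogCoeff_le` (`O((j+1)^k)`),
  `summable_…`, `hasSum_criticalSlopePAdicLCoeff`, `hasSum_logCyclotomicGenerator`;
* `criticalSlopePAdicLCoeff_zero` (`c_0 = μ_Φ(ℤ_p^×)`), and, through the tree's distribution relation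
  of `μ_{f,β}` on compact opens (`sum_fiber_msdMeasure_succ_eq`, `sum_units_msdMeasure_eq`), the
  interpolation at the trivial character
  `constantCoeff_criticalSlopePAdicLFunction_of_isEigenLift : L_p(f_β, 0) = (1 − β⁻¹)² [0]⁺_f`
  (`[0]⁺_f = L(f,1)/Ω⁺_f`; the Euler-type factor `(1 − 1/β)²`);
* `IsEigenLift.criticalSlopePAdicLFunction_eq`, `criticalSlopePAdicLFunctionOf_eq` (independence of
  the eigen-lift).

The interpolation at finite-order characters `χ` of conductor `pⁿ` IN COSET-MOMENT CURRENCY —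
`μ_Φ(χ) = β⁻ⁿ ∑_a χ(a)[a/pⁿ]⁺_f` (`= β⁻ⁿ τ(χ) L(f, χ̄, 1)/Ω⁺`) — is the proved
`charValue_eq_of_specializeFun_eq` of the companion file.  The evaluation statement
"`L_p(Φ, β; χ(γ) − 1) = μ_Φ(χ)`" (PS §9.1, first display; [Bellaiche2012, §1.4.3] "Interpolation",
"Order: … at most `v_p(β)`") is the theory of admissible distributions (Amice–Vélu, Višik) and is NOT
vendored here as a named fact (no consumer needs it as a hypothesis; D-0026): the β-road cruxes use
`L_p(f_β, T)` and its Taylor coefficients at `T = 0` as defined here.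
TODO(general form): tame branches `ψ ≠ 1` of `(ℤ/p^{e₀})^×` and the minus symbol (`Ω⁻`); general
weight `k` (PS work in `Symb_{Γ₀}(𝒟_k)`).

## References

* R. Pollack, G. Stevens, *Overconvergent modular symbols and p-adic L-functions*, Ann. Sci. ÉNS 44
  (2011) 1–42 — cited by the pagination of the authors' version: Def. 6.4 and §6.4 (p. 31), Prop. 6.5
  (p. 31), §9.1 (p. 41), §9.2 (pp. 41–42). [PollackStevens2011]
* R. Pollack, G. Stevens, *Critical slope p-adic L-functions*, J. Lond. Math. Soc. 87 (2013) 428–452.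
  [PollackStevens2013]
* J. Bellaïche, *Critical p-adic L-functions*, Invent. Math. 189 (2012) 1–60, §1.4.2–1.4.3
  (arXiv:0912.2925 pp. 5–6). [Bellaiche2012]
* B. Mazur, J. Tate, J. Teitelbaum, *On p-adic analogues of the conjectures of Birch and
  Swinnerton-Dyer*, Invent. Math. 84 (1986), §I.13 (the variable `T`, `γ`, `⟨x⟩`). [MazurTateTeitelbaum1986Invent]
-/

noncomputable section

open scoped BigOperators MatrixGroups ModularForm
open CongruenceSubgroup PowerSeries Polynomial Literature.NumberTheory.EllipticCurves.ModularForms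

namespace Literature.NumberTheory.EllipticCurves.OMSWeightTwo

variable (p : ℕ) [Fact p.Prime]

/-! ## §1 The Taylor coefficients of `binom(log_γ(1+u), k)` -/

/-- The logarithm series `log(1 + u) = ∑_{j ≥ 1} (−1)^{j+1} uʲ/j ∈ ℚ_p⟦u⟧`
("`log_γ(z·{a}⁻¹) = (1/log_p(γ)) · ∑_{j ≥ 1} ((−1)^{j+1}/j) (z/{a} − 1)ʲ`").
[cite: PollackStevens2011, §9.2 (p. 42)] -/
def logOnePlusSeries : PowerSeries ℚ_[p] :=
  PowerSeries.mk fun j => if j = 0 then 0 else (-1) ^ (j + 1) / (j : ℚ_[p])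

/-- `log_p(γ)` for the topological generator `γ = 1 + p^{e₀}` of `1 + p^{e₀}ℤ_p`
(`γ = cyclotomicGenerator p`): the convergent (`hasSum_logCyclotomicGenerator`) series
`log(1 + u)|_{u = p^{e₀}} = ∑_{j ≥ 1} (−1)^{j+1} p^{e₀ j}/j ∈ ℚ_p` ("`log_γ(z) = log_p(z)/log_p(γ)` for `z`
a `1`-unit"). [cite: PollackStevens2011, §9.1 (p. 41)] [cite: MazurTateTeitelbaum1986Invent, §I.13] -/
def logCyclotomicGenerator : ℚ_[p] :=
  ∑' j : ℕ, coeff j (logOnePlusSeries p) * (p : ℚ_[p]) ^ (cyclotomicExponent p * j)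

/-- The power series `binom(log_γ(1 + u), k) = binom(log_p(1 + u)/log_p(γ), k) ∈ ℚ_p⟦u⟧`,
`binom(X, k) = X(X−1)⋯(X−k+1)/k!` (Mathlib `descPochhammer`): the `k`-th Mahler coefficient function
of `ℓ = log_γ` in the local coordinate `u = ⟨x⟩ − 1`, so that `(1 + T)^{ℓ} = ∑_k binom(ℓ, k) T^k`
("`(w+1)^{log_γ⟨z⟩} = ∑_{n ≥ 0} binom(log_γ⟨z⟩, n) wⁿ`"). [cite: PollackStevens2011, §9.1 (p. 41) and §9.2 (p. 42)] -/
def mahlerLogSeries (k : ℕ) : PowerSeries ℚ_[p] :=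
  ((Nat.factorial k : ℚ_[p])⁻¹) •
    (descPochhammer (PowerSeries ℚ_[p]) k).eval
      (PowerSeries.C (logCyclotomicGenerator p)⁻¹ * logOnePlusSeries p)

/-- The Taylor coefficients `c_j^{(k)} ∈ ℚ_p` with `binom(log_γ(1 + u), k) = ∑_j c_j^{(k)} uʲ`
("`binom(log_γ(z·{a}⁻¹), n) = ∑_j c_j^{(n)} (z/{a} − 1)ʲ` for some elements `c_j^{(n)} ∈ ℚ_p` …
independent of `Φ`"). [cite: PollackStevens2011, §9.2 (p. 42)] -/
def mahlerLogCoeff (k j : ℕ) : ℚ_[p] := coeff j (mahlerLogSeries p k)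

/-- `log(1 + u)` has no constant term. [cite: PollackStevens2011, §9.2 (p. 42)] -/
theorem constantCoeff_logOnePlusSeries : constantCoeff (logOnePlusSeries p) = 0 := by
  simp [logOnePlusSeries, PowerSeries.constantCoeff_mk]

/-- `binom(ℓ, 0) = 1` (the `w⁰`-term of `(w+1)^{log_γ⟨z⟩} = ∑_n binom(log_γ⟨z⟩, n) wⁿ`). [cite: PollackStevens2011, §9.1 (p. 41)] -/
theorem mahlerLogSeries_zero : mahlerLogSeries p 0 = 1 := by
  simp [mahlerLogSeries]

/-- `c_j^{(0)} = δ_{j,0}`. [cite: PollackStevens2011, §9.1 (p. 41) and §9.2 (p. 42)] -/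
theorem mahlerLogCoeff_zero (j : ℕ) : mahlerLogCoeff p 0 j = if j = 0 then 1 else 0 := by
  rw [mahlerLogCoeff, mahlerLogSeries_zero, PowerSeries.coeff_one]

/-- `binom(ℓ, k+1)` has no constant term in `u` (`ℓ = log_γ(1+u)` vanishes at `u = 0` and
`binom(X, k+1) = X · binom(X−1, k)/(k+1)`). [cite: PollackStevens2011, §9.2 (p. 42)] -/
theorem constantCoeff_mahlerLogSeries_succ (k : ℕ) :
    constantCoeff (mahlerLogSeries p (k + 1)) = 0 := by
  rw [mahlerLogSeries, descPochhammer_succ_left, Polynomial.eval_mul, Polynomial.eval_X]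
  simp [constantCoeff_logOnePlusSeries]

/-- `c_0^{(k+1)} = 0`. [cite: PollackStevens2011, §9.2 (p. 42)] -/
theorem mahlerLogCoeff_succ_zero (k : ℕ) : mahlerLogCoeff p (k + 1) 0 = 0 := by
  rw [mahlerLogCoeff, PowerSeries.coeff_zero_eq_constantCoeff_apply]
  exact constantCoeff_mahlerLogSeries_succ p k


variable {p}

/-! ## §2 The moments of `μ_Φ = Φ({∞} − {0})` around the Teichmüller points -/

/-- The residue class `η mod p^{e₀} ∈ ℤ/p^{e₀}` of a Teichmüller representative `η ∈ μ_τ(ℤ_p)`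
(`τ = φ(p^{e₀})`): the unit cosets `η(1 + p^{e₀}ℤ_p) = η + p^{e₀}ℤ_p`, `η ∈ μ_τ`, partition `ℤ_p^×`
(`finsum_teichmullerClass_eq_sum_units`; PS: "`ℤ_p^× ≅ (ℤ/pℤ)^× × (1 + pℤ_p)`", the sum
"`∑_{a=1}^{p−1}`" over the cosets `a + pℤ_p` with Teichmüller representative `{a}`).
[cite: PollackStevens2011, §9.1 (p. 41) and §9.2 (p. 42)] [cite: MazurTateTeitelbaum1986Invent, §I.13] -/
def teichmullerClass (ξ : rootsOfUnity (torsionOrder p) ℤ_[p]) : ZMod (p ^ cyclotomicExponent p) :=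
  PadicInt.toZModPow (cyclotomicExponent p) ((ξ : ℤ_[p]ˣ) : ℤ_[p])

/-- **The shifted moments around a Teichmüller point**:
`∫_{η + p^{e₀}ℤ_p} (x/η − 1)ʲ dμ_Φ(x) = ∑_{r ≤ j} (j choose r) (−1)^{j−r} η^{−r} ∫_{η + p^{e₀}ℤ_p} xʳ dμ_Φ(x)`,
the coset moments being `cosetMoments Φ β e₀ (η mod p^{e₀})` (for a `U_p`-eigensymbol `Φ` of
eigenvalue `β`).  On this coset `⟨x⟩ = x/η ∈ 1 + p^{e₀}ℤ_p`, so these are the moments of `μ_Φ` in the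
local coordinate `u = ⟨x⟩ − 1` in which `binom(log_γ⟨x⟩, k) = ∑_j c_j^{(k)} uʲ` (`mahlerLogCoeff`);
PS (5): "`{a}^{−j} ∫_{a+pℤ_p} (z − {a})ʲ dμ`". [cite: PollackStevens2011, §9.2 (5) (p. 42)] -/
def teichmullerShiftedMoment (Φ : ℚ → Dist p) (β : ℚ_[p])
    (ξ : rootsOfUnity (torsionOrder p) ℤ_[p]) (j : ℕ) : ℚ_[p] :=
  ∑ r ∈ Finset.range (j + 1), ((j.choose r : ℕ) : ℚ_[p]) * (-1) ^ (j - r) *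
    ((((ξ : ℤ_[p]ˣ) : ℤ_[p]) : ℚ_[p])⁻¹) ^ r * cosetMoments Φ β (cyclotomicExponent p) (teichmullerClass ξ) r

/-! ## §3 The coefficients and the power series `L_p(Φ, β; T)` -/

/-- **The `k`-th coefficient of the critical-slope `p`-adic `L`-function**:
`c_k(Φ, β) = ∫_{ℤ_p^×} binom(ℓ(x), k) dμ_Φ(x) = ∑_{η ∈ μ_τ} ∑_{j ≥ 0} c_j^{(k)} ∫_{η + p^{e₀}ℤ_p} (x/η − 1)ʲ dμ_Φ(x)`,
where `⟨x⟩ = γ^{ℓ(x)}`, i.e. `ℓ(x) = log_γ⟨x⟩ = log_p(x/η)/log_p(γ)` on the coset of `η` ("the `n`-th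
coefficient of `L_p(μ, ψ, w)` is `∫_{ℤ_p^×} ψ(z) binom(log_γ⟨z⟩, n) dμ(z) = ∑_{a=1}^{p−1} ψ(a)
∫_{a+pℤ_p} binom(log_γ(z·{a}⁻¹), n) dμ`", here `ψ = 1`; formula (5)).  The series over `j` converges
for `Φ` with values in `𝐃` (`summable_mahlerLogCoeff_mul_teichmullerShiftedMoment`); `tsum` junk
otherwise. [cite: PollackStevens2011, §9.1 (p. 41) and §9.2 (5) (p. 42)] -/
def criticalSlopePAdicLCoeff (Φ : ℚ → Dist p) (β : ℚ_[p]) (k : ℕ) : ℚ_[p] :=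
  ∑ᶠ ξ : rootsOfUnity (torsionOrder p) ℤ_[p],
    ∑' j : ℕ, mahlerLogCoeff p k j * teichmullerShiftedMoment Φ β ξ j

/-- **The critical-slope `p`-adic `L`-function `L_p(Φ, β; T) = ∑_k c_k(Φ, β) T^k ∈ ℚ_p⟦T⟧`** of an
overconvergent `U_p`-eigensymbol `Φ` with eigenvalue `β`:
`L_p(Φ, β; T) = ∫_{ℤ_p^×} (1 + T)^{ℓ(x)} dμ_Φ(x)`, `μ_Φ = Φ({∞} − {0})`, `⟨x⟩ = γ^{ℓ(x)}`,
`γ = cyclotomicGenerator p` (the tree's cyclotomic variable `T ↔ γ − 1` of `padicLFunction f α`,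
MTT §I.13) — Pollack–Stevens' `L_p(μ, ψ, w)` at `ψ = 1`, `w = T`:
"`L_p(μ, ψ, w) = ∫_{ℤ_p^×} ψ(z)·(w+1)^{log_γ⟨z⟩} dμ(z) = ∑_n (∫_{ℤ_p^×} ψ(z) binom(log_γ⟨z⟩, n) dμ(z)) wⁿ`
… a rigid analytic function on the open unit disc".  For `Φ = Φ_β` the critical-slope eigen-lift of the
newform `f` of an elliptic curve this is THE critical-slope `p`-adic `L`-function `L_p(f_β, T)` (PS
Def. 6.4: "`μ_f := Φ_f({∞} − {0})|_{ℤ_p^×}`"; Bellaïche: "`L^±(f_β, σ) := Φ^±_{f_β}({∞} − {0})(σ)`", of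
"order at most `v_p(β)`", with the interpolation property at the characters `t ↦ φ(t)tʲ`, here `j = 0`:
`charValue_eq_of_specializeFun_eq`), defined THROUGH `Φ` and not by interpolation (which does not
determine it at critical slope, PS §6.4).  Plus part / trivial tame character only.
[cite: PollackStevens2011, §9.1 (p. 41), Def. 6.4 and §6.4 (p. 31)] [cite: PollackStevens2013]
[cite: Bellaiche2012, §1.4.2–1.4.3 (arXiv:0912.2925 pp. 5–6)] [cite: MazurTateTeitelbaum1986Invent, §I.13] -/
def criticalSlopePAdicLFunction {M : ℕ} (Φ : OMSymb p M) (β : ℚ_[p]) : PowerSeries ℚ_[p] :=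
  PowerSeries.mk (criticalSlopePAdicLCoeff Φ.toFun β)

open Classical in
/-- **`L_p(f_β, T)` of the refinement `f_β` of the newform `f` of `W`**: the critical-slope `p`-adic
`L`-function of an eigen-lift `Φ_β` of `φ_β` (`IsEigenLift W f β Φ_β`), independent of the choice by
`IsEigenLift.unique` under `SpecializeInjOnEigenspace W N β` (`criticalSlopePAdicLFunctionOf_eq`);
junk `0` when no eigen-lift exists (existence for good ordinary non-`θ`-critical `(W, p, β)`,
`v_p(β) = 1`, is the named fact `pollackStevens_criticalSlope_eigenLift`).  This replaces the junk
`padicLFunction f β` (a `limUnder` of non-convergent Riemann sums) for the NON-unit root `β = p/α`.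
[cite: PollackStevens2011, Def. 6.4 (p. 31) and §9.1 (p. 41)] [cite: Bellaiche2012, §1.4.2 (arXiv:0912.2925 p. 5)] -/
def criticalSlopePAdicLFunctionOf (W : WeierstrassCurve ℚ) {N : ℕ} (f : CuspForm (Gamma0 N) 2)
    (β : ℚ_[p]) : PowerSeries ℚ_[p] :=
  if h : ∃ Φ : OMSymb p (N * p), IsEigenLift W f β Φ then
    criticalSlopePAdicLFunction h.choose β else 0

/-! ## §4 Proved API -/

/-- The `k`-th coefficient of `L_p(Φ, β; T)` is `c_k(Φ, β)`. [cite: PollackStevens2011, §9.1 (p. 41)] -/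
@[simp] theorem coeff_criticalSlopePAdicLFunction {M : ℕ} (Φ : OMSymb p M) (β : ℚ_[p]) (k : ℕ) :
    coeff k (criticalSlopePAdicLFunction Φ β) = criticalSlopePAdicLCoeff Φ.toFun β k :=
  PowerSeries.coeff_mk _ _

/-- The constant term of `L_p(Φ, β; T)` is `c_0(Φ, β)`. [cite: PollackStevens2011, §9.1 (p. 41)] -/
@[simp] theorem constantCoeff_criticalSlopePAdicLFunction {M : ℕ} (Φ : OMSymb p M) (β : ℚ_[p]) :
    constantCoeff (criticalSlopePAdicLFunction Φ β) = criticalSlopePAdicLCoeff Φ.toFun β 0 :=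
  PowerSeries.constantCoeff_mk

/-- `L_p(Φ, β; T)` depends only on the value function of `Φ` (it is built from `Φ({∞} − {a/p^{e₀}})`). [cite: PollackStevens2011, Def. 6.4 (p. 31) and §9.2 (p. 42)] -/
theorem criticalSlopePAdicLFunction_eq_of_toFun_eq {M : ℕ} {Φ Φ' : OMSymb p M}
    (h : Φ.toFun = Φ'.toFun) (β : ℚ_[p]) :
    criticalSlopePAdicLFunction Φ β = criticalSlopePAdicLFunction Φ' β := by
  unfold criticalSlopePAdicLFunction
  rw [h]

/-- **Independence of the eigen-lift** ("the unique overconvergent eigensymbol … which specializes to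
`φ_f`"): two eigen-lifts of `φ_β` have the same `L_p(·, β; T)` under non-`θ`-criticality.
[cite: PollackStevens2011, Def. 6.4 (p. 31)] -/
theorem IsEigenLift.criticalSlopePAdicLFunction_eq {W : WeierstrassCurve ℚ} {N : ℕ}
    {f : CuspForm (Gamma0 N) 2} {β : ℚ_[p]} (hθ : SpecializeInjOnEigenspace W N β)
    {Φ Φ' : OMSymb p (N * p)} (h : IsEigenLift W f β Φ) (h' : IsEigenLift W f β Φ') :
    criticalSlopePAdicLFunction Φ β = criticalSlopePAdicLFunction Φ' β :=
  criticalSlopePAdicLFunction_eq_of_toFun_eq (h.unique hθ h') β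

/-- **`L_p(f_β, T)` is computed by ANY eigen-lift** (under non-`θ`-criticality).
[cite: PollackStevens2011, Def. 6.4 (p. 31)] -/
theorem criticalSlopePAdicLFunctionOf_eq {W : WeierstrassCurve ℚ} {N : ℕ}
    {f : CuspForm (Gamma0 N) 2} {β : ℚ_[p]} (hθ : SpecializeInjOnEigenspace W N β)
    {Φ : OMSymb p (N * p)} (h : IsEigenLift W f β Φ) :
    criticalSlopePAdicLFunctionOf W f β = criticalSlopePAdicLFunction Φ β := by
  classical
  have hex : ∃ Φ : OMSymb p (N * p), IsEigenLift W f β Φ := ⟨Φ, h⟩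
  unfold criticalSlopePAdicLFunctionOf
  rw [dif_pos hex]
  exact IsEigenLift.criticalSlopePAdicLFunction_eq hθ hex.choose_spec h

/-- Without an eigen-lift, `criticalSlopePAdicLFunctionOf` is the junk value `0`. [cite: PollackStevens2011, Def. 6.4 (p. 31)] -/
theorem criticalSlopePAdicLFunctionOf_of_not_exists {W : WeierstrassCurve ℚ} {N : ℕ}
    {f : CuspForm (Gamma0 N) 2} {β : ℚ_[p]} (h : ¬ ∃ Φ : OMSymb p (N * p), IsEigenLift W f β Φ) :
    criticalSlopePAdicLFunctionOf W f β = 0 := by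
  classical
  unfold criticalSlopePAdicLFunctionOf
  rw [dif_neg h]

/-- The `0`-th shifted moment is the mass of the coset: `∫_{η + p^{e₀}ℤ_p} dμ_Φ`. [cite: PollackStevens2011, §9.2 (p. 42)] -/
theorem teichmullerShiftedMoment_zero (Φ : ℚ → Dist p) (β : ℚ_[p])
    (ξ : rootsOfUnity (torsionOrder p) ℤ_[p]) :
    teichmullerShiftedMoment Φ β ξ 0 = cosetMoments Φ β (cyclotomicExponent p) (teichmullerClass ξ) 0 := by
  simp [teichmullerShiftedMoment]

/-- **The constant term is the mass of `ℤ_p^×`**: `c_0(Φ, β) = ∑_{η ∈ μ_τ} ∫_{η + p^{e₀}ℤ_p} dμ_Φ`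
(`binom(ℓ, 0) = 1`: `L_p(μ, ψ, 0) = ∫_{ℤ_p^×} ψ dμ`). [cite: PollackStevens2011, §9.1 (p. 41)] -/
theorem criticalSlopePAdicLCoeff_zero (Φ : ℚ → Dist p) (β : ℚ_[p]) :
    criticalSlopePAdicLCoeff Φ β 0 = ∑ᶠ ξ : rootsOfUnity (torsionOrder p) ℤ_[p],
      cosetMoments Φ β (cyclotomicExponent p) (teichmullerClass ξ) 0 := by
  unfold criticalSlopePAdicLCoeff
  refine finsum_congr fun ξ => ?_
  rw [tsum_eq_single 0]
  · rw [mahlerLogCoeff_zero, if_pos rfl, one_mul, teichmullerShiftedMoment_zero]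
  · intro j hj
    rw [mahlerLogCoeff_zero, if_neg hj, zero_mul]

/-! ## §5 The constant term `L_p(f_β, 0) = (1 − β⁻¹)² · L(f,1)/Ω⁺` -/

/-- The Teichmüller classes are units. [folklore] -/
private theorem isUnit_teichmullerClass (ξ : rootsOfUnity (torsionOrder p) ℤ_[p]) :
    IsUnit (teichmullerClass ξ) :=
  (Units.isUnit (ξ : ℤ_[p]ˣ)).map _

/-- **`μ_τ → (ℤ/p^{e₀})^×`, `η ↦ η mod p^{e₀}` is a bijection**: summing over the Teichmüller
representatives is summing over the unit classes modulo `p^{e₀}` (injective by the tree's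
`toZModPow_rootsOfUnity_injective`, same cardinality `τ = φ(p^{e₀})` by `card_rootsOfUnity_torsionOrder`).
[cite: MazurTateTeitelbaum1986Invent, §I.13] -/
theorem finsum_teichmullerClass_eq_sum_units {M : Type*} [AddCommMonoid M]
    (g : ZMod (p ^ cyclotomicExponent p) → M) :
    ∑ᶠ ξ : rootsOfUnity (torsionOrder p) ℤ_[p], g (teichmullerClass ξ) =
      ∑ u : (ZMod (p ^ cyclotomicExponent p))ˣ, g u := by
  classical
  haveI := neZero_torsionOrder p
  haveI := Fintype.ofFinite (rootsOfUnity (torsionOrder p) ℤ_[p])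
  haveI : NeZero (p ^ cyclotomicExponent p) := ⟨pow_ne_zero _ (Fact.out : p.Prime).ne_zero⟩
  rw [finsum_eq_sum_of_fintype]
  set F : rootsOfUnity (torsionOrder p) ℤ_[p] → (ZMod (p ^ cyclotomicExponent p))ˣ :=
    fun ξ => (isUnit_teichmullerClass ξ).unit with hF
  have hinj : Function.Injective F := by
    intro x y hxy
    have h := congr_arg Units.val hxy
    simp only [hF, IsUnit.unit_spec] at h
    exact toZModPow_rootsOfUnity_injective p h
  have hcard : Fintype.card (rootsOfUnity (torsionOrder p) ℤ_[p]) =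
      Fintype.card (ZMod (p ^ cyclotomicExponent p))ˣ := by
    rw [ZMod.card_units_eq_totient, ← Nat.card_eq_fintype_card, card_rootsOfUnity_torsionOrder]
    rfl
  have hbij : Function.Bijective F :=
    (Fintype.bijective_iff_injective_and_card F).mpr ⟨hinj, hcard⟩
  exact Fintype.sum_bijective F hbij _ _ fun x => by simp only [hF, IsUnit.unit_spec]

/-- The coset masses at any level `n ≥ 1` are the tree's `msdMeasure f β` when `ρ₀^*(Φ) = φ_β`
(`cosetMoments_apply_zero_eq_msdMeasure`). [cite: PollackStevens2011, §6.4 (p. 31)] [cite: MazurTateTeitelbaum1986Invent, §I.10 (10.1)] -/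
theorem cosetMoments_apply_zero_eq_msdMeasure_of_ne_zero {N : ℕ} (f : CuspForm (Gamma0 N) 2)
    (β : ℚ_[p]) (Φ : ℚ → Dist p) (hΦ : specializeFun Φ = phiBeta f β) {n : ℕ} (hn : n ≠ 0)
    (a : ZMod (p ^ n)) : cosetMoments Φ β n a 0 = msdMeasure f β n a := by
  obtain ⟨m, rfl⟩ := Nat.exists_eq_succ_of_ne_zero hn
  exact cosetMoments_apply_zero_eq_msdMeasure f β Φ hΦ m a

/-- **The constant term from the distribution relation**: if `ρ₀^*(Φ) = φ_β` and `μ_{f,β}` satisfies the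
distribution relation on compact opens, then `c_0(Φ, β) = μ_{f,β}(ℤ_p^×) = (1 − β⁻¹)² [0]⁺_f`
(the tree's `sum_units_msdMeasure_eq`: `μ(ℤ_p^×) = μ(ℤ_p) − μ(pℤ_p) = (1 − β⁻¹)²[0]⁺`).
[cite: MazurTateTeitelbaum1986Invent, §I.14 (14.3), trivial character] [cite: PollackStevens2011, Prop. 6.5 (p. 31)] -/
theorem criticalSlopePAdicLCoeff_zero_eq_of_specializeFun_eq {N : ℕ} [NeZero N]
    (f : CuspForm (Gamma0 N) 2) (β : ℚ_[p]) (Φ : ℚ → Dist p)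
    (hΦ : specializeFun Φ = phiBeta f β)
    (hdist : ∀ (n : ℕ) (a : ZMod (p ^ n)),
      ∑ b ∈ Finset.univ.filter (fun b : ZMod (p ^ (n + 1)) ↦
        ZMod.castHom (pow_dvd_pow p n.le_succ) (ZMod (p ^ n)) b = a), msdMeasure f β (n + 1) b =
        msdMeasure f β n a) :
    criticalSlopePAdicLCoeff Φ β 0 = (1 - β⁻¹) ^ 2 * (ratPlusSymbol f 0 : ℚ_[p]) := by
  rw [criticalSlopePAdicLCoeff_zero,
    finsum_teichmullerClass_eq_sum_units (fun u => cosetMoments Φ β (cyclotomicExponent p) u 0)]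
  simp_rw [cosetMoments_apply_zero_eq_msdMeasure_of_ne_zero f β Φ hΦ (cyclotomicExponent_ne_zero p)]
  exact sum_units_msdMeasure_eq hdist (Nat.one_le_iff_ne_zero.mpr (cyclotomicExponent_ne_zero p))

/-- **`L_p(f_β, 0) = (1 − β⁻¹)² · L(E,1)/Ω⁺` for the newform of an elliptic curve.**  Let `f` be the
newform of `W/ℚ` (level `N`, `p ∤ N`), `β ≠ 0` a root of `X² − a_p(W) X + p`, and `Φ` an eigen-lift of
`φ_β`.  Then the constant term of `L_p(Φ, β; T)` is `(1 − β⁻¹)² [0]⁺_f` — the Euler-type factor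
`(1 − 1/β)²` at the trivial character; the distribution relation of `μ_{f,β}` comes from the Hecke
relation at `p` (`sum_fiber_msdMeasure_succ_eq`, Manin–Drinfeld rationality for `f`).  Same shape as
the first clause of the tree's `IsPAdicLFunctionOf f p β`. [cite: MazurTateTeitelbaum1986Invent, §I.14 (14.3)]
[cite: PollackStevens2011, Prop. 6.5 (p. 31)] [cite: Bellaiche2012, §1.4.3 "Interpolation" (arXiv:0912.2925 p. 6)] -/
theorem constantCoeff_criticalSlopePAdicLFunction_of_isEigenLift {W : WeierstrassCurve ℚ}
    [W.IsGloballyMinimal] [W.IsElliptic] {N : ℕ} [NeZero N] {f : CuspForm (Gamma0 N) 2}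
    (hf : IsNewformOf W f) (hpN : ¬ p ∣ N) {β : ℚ_[p]} (hβ0 : β ≠ 0)
    (hβ : β ^ 2 - (W.LFunction p : ℚ_[p]) * β + p = 0) {Φ : OMSymb p (N * p)}
    (hΦ : IsEigenLift W f β Φ) :
    constantCoeff (criticalSlopePAdicLFunction Φ β) = (1 - β⁻¹) ^ 2 * (ratPlusSymbol f 0 : ℚ_[p]) := by
  rw [constantCoeff_criticalSlopePAdicLFunction]
  refine criticalSlopePAdicLCoeff_zero_eq_of_specializeFun_eq f β Φ.toFun hΦ.specialize_eq ?_
  intro n a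
  exact sum_fiber_msdMeasure_succ_eq
    (ratCast_ratPlusSymbol_of_maninDrinfeld (exists_nsmul_modularSymbol_mem_periodLattice_of_isNewformOf hf))
    hf.1 hpN (hf.2 p) hβ0 (by exact_mod_cast hβ) n a

/-- The same for `L_p(f_β, T) = criticalSlopePAdicLFunctionOf W f β` (under non-`θ`-criticality, so
that the eigen-lift in the definition is the given one up to `IsEigenLift.unique`).
[cite: PollackStevens2011, Prop. 6.5 and Def. 6.4 (p. 31)] -/
theorem constantCoeff_criticalSlopePAdicLFunctionOf {W : WeierstrassCurve ℚ}
    [W.IsGloballyMinimal] [W.IsElliptic] {N : ℕ} [NeZero N] {f : CuspForm (Gamma0 N) 2}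
    (hf : IsNewformOf W f) (hpN : ¬ p ∣ N) {β : ℚ_[p]} (hβ0 : β ≠ 0)
    (hβ : β ^ 2 - (W.LFunction p : ℚ_[p]) * β + p = 0) (hθ : SpecializeInjOnEigenspace W N β)
    {Φ : OMSymb p (N * p)} (hΦ : IsEigenLift W f β Φ) :
    constantCoeff (criticalSlopePAdicLFunctionOf W f β) =
      (1 - β⁻¹) ^ 2 * (ratPlusSymbol f 0 : ℚ_[p]) := by
  rw [criticalSlopePAdicLFunctionOf_eq hθ hΦ]
  exact constantCoeff_criticalSlopePAdicLFunction_of_isEigenLift hf hpN hβ0 hβ hΦ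

/-! ## §6 Pollack–Stevens' formula for the shifted moments through the moments of `Φ(D_a)` -/

/-- Binomial re-expansion: `∑_r (j choose r)(−1)^{j−r} cʳ ∑_{m ≤ r} (r choose m) x^{r−m} yᵐ ν_m
= ∑_m (j choose m)(xc − 1)^{j−m}(yc)ᵐ ν_m` (both are "`ν` applied to `(c(x + yz) − 1)ʲ`"). [folklore] -/
private theorem sum_choose_mul_neg_one_pow_mul_sum_eq {R : Type*} [CommRing R] (x y c : R) (ν : ℕ → R)
    (j : ℕ) :
    ∑ r ∈ Finset.range (j + 1), ((j.choose r : ℕ) : R) * (-1) ^ (j - r) * c ^ r *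
        ∑ m ∈ Finset.range (r + 1), ((r.choose m : ℕ) : R) * x ^ (r - m) * y ^ m * ν m =
      ∑ m ∈ Finset.range (j + 1), ((j.choose m : ℕ) : R) * (x * c - 1) ^ (j - m) * (y * c) ^ m *
        ν m := by
  simp_rw [Finset.mul_sum]
  rw [Finset.sum_comm' (t' := Finset.range (j + 1)) (s' := fun m => Finset.Ico m (j + 1))]
  · refine Finset.sum_congr rfl fun m hm => ?_
    have hmj : m ≤ j := Nat.lt_succ_iff.mp (Finset.mem_range.mp hm)
    rw [Finset.sum_Ico_eq_sum_range, show j + 1 - m = j - m + 1 by omega, sub_eq_add_neg (x * c) 1,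
      add_pow, Finset.mul_sum, Finset.sum_mul, Finset.sum_mul]
    refine Finset.sum_congr rfl fun i _ => ?_
    have hc := Nat.choose_mul (n := j) (Nat.le_add_right m i)
    rw [Nat.add_sub_cancel_left] at hc
    have hc' : ((j.choose (m + i) : ℕ) : R) * (((m + i).choose m : ℕ) : R) =
        ((j.choose m : ℕ) : R) * (((j - m).choose i : ℕ) : R) := by
      rw [← Nat.cast_mul, ← Nat.cast_mul, hc]
    rw [Nat.add_sub_cancel_left, Nat.sub_add_eq]
    linear_combination ((-1 : R) ^ (j - m - i) * x ^ i * y ^ m * ν m * c ^ (m + i)) * hc'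
  · intro r m
    simp only [Finset.mem_range, Finset.mem_Ico]
    omega

/-- **Pollack–Stevens' formula (§9.2): the shifted moments through the moments of `Φ(D_a)`.**
With `a ∈ [0, p^{e₀})` the representative of `η mod p^{e₀}` and `D_a = {∞} − {a/p^{e₀}}`:
`∫_{η + p^{e₀}ℤ_p} (x/η − 1)ʲ dμ_Φ = β^{−e₀} Φ(D_a)(((a/η − 1) + (p^{e₀}/η) z)ʲ)
 = β^{−e₀} ∑_{m ≤ j} (j choose m) (a/η − 1)^{j−m} (p^{e₀}/η)ᵐ Φ(D_a)(zᵐ)`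
("`∫_{a+pℤ_p}(z − {a})ʲ dμ = (1/λ) Φ(D_a)(((a − {a}) + pz)ʲ) = (1/λ) ∑_r (j choose r)(a − {a})^{j−r} pʳ Φ(D_a)(zʳ)`",
here divided by `{a}ʲ = ηʲ`).  Since `a ≡ η (mod p^{e₀})` every term is `O(p^{e₀ j})`
(`norm_teichmullerShiftedMoment_le`). [cite: PollackStevens2011, §9.2 (p. 42), display after (5)] -/
theorem teichmullerShiftedMoment_eq_sum (Φ : ℚ → Dist p) (β : ℚ_[p])
    (ξ : rootsOfUnity (torsionOrder p) ℤ_[p]) (j : ℕ) :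
    teichmullerShiftedMoment Φ β ξ j = β⁻¹ ^ cyclotomicExponent p *
      ∑ m ∈ Finset.range (j + 1), ((j.choose m : ℕ) : ℚ_[p]) *
        (((teichmullerClass ξ).val : ℚ_[p]) * ((((ξ : ℤ_[p]ˣ) : ℤ_[p]) : ℚ_[p])⁻¹) - 1) ^ (j - m) *
        ((p : ℚ_[p]) ^ cyclotomicExponent p * ((((ξ : ℤ_[p]ˣ) : ℤ_[p]) : ℚ_[p])⁻¹)) ^ m *
        Φ (((teichmullerClass ξ).val : ℚ) / (p : ℚ) ^ cyclotomicExponent p) m := by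
  rw [← sum_choose_mul_neg_one_pow_mul_sum_eq, Finset.mul_sum]
  unfold teichmullerShiftedMoment cosetMoments
  refine Finset.sum_congr rfl fun r _ => ?_
  simp only [Pi.smul_apply, smul_eq_mul, act_heckeMat]
  push_cast
  ring

/-! ## §7 The shifted moments are `O(p^{−e₀ j})` -/

/-- `a ≡ η (mod p^{e₀})` for the representative `a ∈ [0, p^{e₀})` of the class of `η` ("since `a` and
`{a}` are congruent mod `p`"). [cite: PollackStevens2011, §9.2 (p. 42)] -/
theorem norm_teichmullerClass_val_sub_le (ξ : rootsOfUnity (torsionOrder p) ℤ_[p]) :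
    ‖(((teichmullerClass ξ).val : ℕ) : ℤ_[p]) - ((ξ : ℤ_[p]ˣ) : ℤ_[p])‖ ≤
      (p : ℝ) ^ (-(cyclotomicExponent p : ℤ)) := by
  haveI : NeZero (p ^ cyclotomicExponent p) := ⟨pow_ne_zero _ (Fact.out : p.Prime).ne_zero⟩
  rw [PadicInt.norm_le_pow_iff_mem_span_pow, ← PadicInt.ker_toZModPow, RingHom.mem_ker, map_sub,
    map_natCast, ZMod.natCast_zmod_val, teichmullerClass, sub_self]

/-- Natural numbers have norm `≤ 1` in `ℚ_p`. [folklore] -/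
private theorem norm_natCast_padic_le_one (n : ℕ) : ‖(n : ℚ_[p])‖ ≤ 1 := by
  simpa using Padic.norm_int_le_one (p := p) (n : ℤ)

/-- **The shifted moments decay like `p^{−e₀ j}`**: if the moments of `Φ(D_a)` are bounded by `C`
then `‖∫_{η + p^{e₀}ℤ_p} (x/η − 1)ʲ dμ_Φ‖ ≤ ‖β⁻¹‖^{e₀} · p^{−e₀ j} · C` ("`p^{j − ord_p(λ)}` divides
`∫_{a+pℤ_p}(z − {a})ʲ dμ` … since `a` and `{a}` are congruent mod `p`").  This is what makes the series
defining the coefficients `c_k(Φ, β)` converge although `μ_Φ` is not a measure.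
[cite: PollackStevens2011, §9.2 (p. 42): "p^{j−ord_p(λ)} divides ∫_{a+pℤ_p}(z−{a})^j dμ"] -/
theorem norm_teichmullerShiftedMoment_le (Φ : ℚ → Dist p) (β : ℚ_[p])
    (ξ : rootsOfUnity (torsionOrder p) ℤ_[p]) {C : ℝ} (hC0 : 0 ≤ C)
    (hC : ∀ m, ‖Φ (((teichmullerClass ξ).val : ℚ) / (p : ℚ) ^ cyclotomicExponent p) m‖ ≤ C)
    (j : ℕ) :
    ‖teichmullerShiftedMoment Φ β ξ j‖ ≤
      ‖β⁻¹‖ ^ cyclotomicExponent p * (((p : ℝ) ^ (-(cyclotomicExponent p : ℤ))) ^ j * C) := by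
  rw [teichmullerShiftedMoment_eq_sum, norm_mul, norm_pow]
  refine mul_le_mul_of_nonneg_left ?_ (pow_nonneg (norm_nonneg _) _)
  refine IsUltrametricDist.norm_sum_le_of_forall_le_of_nonneg (by positivity) fun m hm => ?_
  have hmj : m ≤ j := Nat.lt_succ_iff.mp (Finset.mem_range.mp hm)
  set w : ℚ_[p] := (((ξ : ℤ_[p]ˣ) : ℤ_[p]) : ℚ_[p]) with hw
  have hwn : ‖w‖ = 1 := by rw [hw, ← PadicInt.norm_def, PadicInt.norm_units]
  have hw0 : w ≠ 0 := norm_ne_zero_iff.mp (by rw [hwn]; exact one_ne_zero)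
  have hwinv : ‖w⁻¹‖ = 1 := by rw [norm_inv, hwn, inv_one]
  have h1 : ‖((teichmullerClass ξ).val : ℚ_[p]) * w⁻¹ - 1‖ ≤ (p : ℝ) ^ (-(cyclotomicExponent p : ℤ)) := by
    have hre : ((teichmullerClass ξ).val : ℚ_[p]) * w⁻¹ - 1 =
        w⁻¹ * (((teichmullerClass ξ).val : ℚ_[p]) - w) := by
      field_simp
    rw [hre, norm_mul, hwinv, one_mul]
    have h := norm_teichmullerClass_val_sub_le ξ
    rwa [PadicInt.norm_def, PadicInt.coe_sub, PadicInt.coe_natCast] at h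
  have h2 : ‖(p : ℚ_[p]) ^ cyclotomicExponent p * w⁻¹‖ ≤ (p : ℝ) ^ (-(cyclotomicExponent p : ℤ)) := by
    rw [norm_mul, hwinv, mul_one, Padic.norm_p_pow]
  calc ‖((j.choose m : ℕ) : ℚ_[p]) *
          (((teichmullerClass ξ).val : ℚ_[p]) * w⁻¹ - 1) ^ (j - m) *
          ((p : ℚ_[p]) ^ cyclotomicExponent p * w⁻¹) ^ m *
          Φ (((teichmullerClass ξ).val : ℚ) / (p : ℚ) ^ cyclotomicExponent p) m‖
      = ‖((j.choose m : ℕ) : ℚ_[p])‖ * ‖((teichmullerClass ξ).val : ℚ_[p]) * w⁻¹ - 1‖ ^ (j - m) *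
          ‖(p : ℚ_[p]) ^ cyclotomicExponent p * w⁻¹‖ ^ m *
          ‖Φ (((teichmullerClass ξ).val : ℚ) / (p : ℚ) ^ cyclotomicExponent p) m‖ := by
        rw [norm_mul, norm_mul, norm_mul, norm_pow, norm_pow]
    _ ≤ 1 * ((p : ℝ) ^ (-(cyclotomicExponent p : ℤ))) ^ (j - m) *
          ((p : ℝ) ^ (-(cyclotomicExponent p : ℤ))) ^ m * C := by
        gcongr
        · exact norm_natCast_padic_le_one (j.choose m)
        · exact hC m
    _ = ((p : ℝ) ^ (-(cyclotomicExponent p : ℤ))) ^ j * C := by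
        rw [one_mul, ← pow_add, Nat.sub_add_cancel hmj]

/-! ## §8 Growth of the Taylor coefficients `c_j^{(k)}` and convergence of the coefficient series -/

variable (p) in
/-- `‖[uʲ] log(1 + u)‖ = ‖1/j‖_p = p^{v_p(j)} ≤ j` (and `0` for `j = 0`) ("their `p`-adic valuations are easily computed"). [cite: PollackStevens2011, §9.2 (p. 42)] -/
theorem norm_coeff_logOnePlusSeries_le (j : ℕ) :
    ‖coeff j (logOnePlusSeries p)‖ ≤ ((j + 1 : ℕ) : ℝ) := by
  have hp : p.Prime := Fact.out
  rw [logOnePlusSeries, PowerSeries.coeff_mk]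
  rcases Nat.eq_zero_or_pos j with rfl | hj
  · simp
  · rw [if_neg hj.ne', norm_div, norm_pow, norm_neg, norm_one, one_pow, one_div]
    have hj0 : (j : ℚ_[p]) ≠ 0 := Nat.cast_ne_zero.mpr hj.ne'
    rw [Padic.norm_eq_zpow_neg_valuation hj0, Padic.valuation_natCast, ← zpow_neg, neg_neg,
      zpow_natCast]
    have hle : p ^ padicValNat p j ≤ j := Nat.le_of_dvd hj pow_padicValNat_dvd
    exact_mod_cast hle.trans (Nat.le_succ j)

/-- **Products of series with polynomially bounded coefficients** (ultrametric): if
`‖[uⁱ]F‖ ≤ A (i+1)^a` and `‖[uⁱ]G‖ ≤ B (i+1)^b` then `‖[uʲ](FG)‖ ≤ A B (j+1)^{a+b}`. [folklore] -/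
private theorem norm_coeff_mul_le_of_polynomial_growth {F G : PowerSeries ℚ_[p]} {A B : ℝ} {a b : ℕ}
    (hA : 0 ≤ A) (hB : 0 ≤ B) (hF : ∀ i, ‖coeff i F‖ ≤ A * ((i + 1 : ℕ) : ℝ) ^ a)
    (hG : ∀ i, ‖coeff i G‖ ≤ B * ((i + 1 : ℕ) : ℝ) ^ b) (j : ℕ) :
    ‖coeff j (F * G)‖ ≤ A * B * ((j + 1 : ℕ) : ℝ) ^ (a + b) := by
  rw [PowerSeries.coeff_mul]
  refine IsUltrametricDist.norm_sum_le_of_forall_le_of_nonneg (by positivity) fun x hx => ?_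
  have hx' : x.1 + x.2 = j := Finset.HasAntidiagonal.mem_antidiagonal.mp hx
  have h1 : x.1 ≤ j := by omega
  have h2 : x.2 ≤ j := by omega
  rw [norm_mul]
  calc ‖coeff x.1 F‖ * ‖coeff x.2 G‖
      ≤ (A * ((x.1 + 1 : ℕ) : ℝ) ^ a) * (B * ((x.2 + 1 : ℕ) : ℝ) ^ b) :=
        mul_le_mul (hF _) (hG _) (norm_nonneg _) (by positivity)
    _ ≤ (A * ((j + 1 : ℕ) : ℝ) ^ a) * (B * ((j + 1 : ℕ) : ℝ) ^ b) := by
        gcongr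
    _ = A * B * ((j + 1 : ℕ) : ℝ) ^ (a + b) := by ring

variable (p) in
/-- The factors `L − n`, `L = log_p(1+u)/log_p(γ)`, have coefficients bounded by `M (i+1)`,
`M = max(‖log_p(γ)⁻¹‖, 1)`. [folklore] -/
private theorem norm_coeff_logQuotient_sub_natCast_le (n i : ℕ) :
    ‖coeff i (PowerSeries.C (logCyclotomicGenerator p)⁻¹ * logOnePlusSeries p - (n : PowerSeries ℚ_[p]))‖ ≤
      max ‖(logCyclotomicGenerator p)⁻¹‖ 1 * ((i + 1 : ℕ) : ℝ) ^ 1 := by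
  rw [map_sub, PowerSeries.coeff_C_mul, ← map_natCast (PowerSeries.C (R := ℚ_[p])) n,
    PowerSeries.coeff_C, pow_one, sub_eq_add_neg]
  refine (IsUltrametricDist.norm_add_le_max _ _).trans (max_le ?_ ?_)
  · rw [norm_mul]
    calc ‖(logCyclotomicGenerator p)⁻¹‖ * ‖coeff i (logOnePlusSeries p)‖
        ≤ ‖(logCyclotomicGenerator p)⁻¹‖ * ((i + 1 : ℕ) : ℝ) :=
          mul_le_mul_of_nonneg_left (norm_coeff_logOnePlusSeries_le p i) (norm_nonneg _)
      _ ≤ max ‖(logCyclotomicGenerator p)⁻¹‖ 1 * ((i + 1 : ℕ) : ℝ) := by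
          gcongr
          exact le_max_left _ _
  · rw [norm_neg]
    calc ‖(if i = 0 then (n : ℚ_[p]) else 0)‖ ≤ 1 := by
          split_ifs
          · exact norm_natCast_padic_le_one n
          · simp
      _ ≤ max ‖(logCyclotomicGenerator p)⁻¹‖ 1 * ((i + 1 : ℕ) : ℝ) := by
          have h1 : (1 : ℝ) ≤ max ‖(logCyclotomicGenerator p)⁻¹‖ 1 := le_max_right _ _
          have h2 : (1 : ℝ) ≤ ((i + 1 : ℕ) : ℝ) := by exact_mod_cast Nat.succ_pos i
          nlinarith

variable (p) in
/-- `‖[uʲ] L(L−1)⋯(L−k+1)‖ ≤ M^k (j+1)^k`. [folklore] -/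
private theorem norm_coeff_descPochhammer_eval_le (k j : ℕ) :
    ‖coeff j ((descPochhammer (PowerSeries ℚ_[p]) k).eval
        (PowerSeries.C (logCyclotomicGenerator p)⁻¹ * logOnePlusSeries p))‖ ≤
      (max ‖(logCyclotomicGenerator p)⁻¹‖ 1) ^ k * ((j + 1 : ℕ) : ℝ) ^ k := by
  induction k generalizing j with
  | zero =>
    rw [descPochhammer_zero, Polynomial.eval_one, PowerSeries.coeff_one, pow_zero, pow_zero, one_mul]
    split_ifs <;> simp
  | succ k ih =>
    rw [descPochhammer_succ_eval, pow_succ]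
    exact norm_coeff_mul_le_of_polynomial_growth (pow_nonneg (le_max_of_le_right zero_le_one) k)
      (le_max_of_le_right zero_le_one) ih (norm_coeff_logQuotient_sub_natCast_le p k) j

variable (p) in
/-- **Polynomial growth of the Taylor coefficients**: `‖c_j^{(k)}‖ ≤ ‖1/k!‖ · M^k · (j+1)^k`
("the constants `c_j^{(n)}` are independent of `Φ`, and their `p`-adic valuations are easily computed").
[cite: PollackStevens2011, §9.2 (p. 42)] -/
theorem norm_mahlerLogCoeff_le (k j : ℕ) :
    ‖mahlerLogCoeff p k j‖ ≤ ‖((Nat.factorial k : ℕ) : ℚ_[p])⁻¹‖ *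
      ((max ‖(logCyclotomicGenerator p)⁻¹‖ 1) ^ k * ((j + 1 : ℕ) : ℝ) ^ k) := by
  rw [mahlerLogCoeff, mahlerLogSeries, PowerSeries.coeff_smul, smul_eq_mul, norm_mul]
  exact mul_le_mul_of_nonneg_left (norm_coeff_descPochhammer_eval_le p k j) (norm_nonneg _)

/-- **The series defining `c_k(Φ, β)` converge** for an overconvergent symbol (values in `𝐃`):
the terms are `O((j+1)^k p^{−e₀ j})` ("one can bound the size of the tail-end of the series in (5)").
[cite: PollackStevens2011, §9.2 (p. 42)] -/
theorem summable_mahlerLogCoeff_mul_teichmullerShiftedMoment {M : ℕ} (Φ : OMSymb p M) (β : ℚ_[p])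
    (ξ : rootsOfUnity (torsionOrder p) ℤ_[p]) (k : ℕ) :
    Summable fun j => mahlerLogCoeff p k j * teichmullerShiftedMoment Φ.toFun β ξ j := by
  have hp : p.Prime := Fact.out
  obtain ⟨C, hC⟩ := Φ.isBounded (((teichmullerClass ξ).val : ℚ) / (p : ℚ) ^ cyclotomicExponent p)
  have hC0 : 0 ≤ C := (norm_nonneg _).trans (hC 0)
  set r : ℝ := (p : ℝ) ^ (-(cyclotomicExponent p : ℤ)) with hr
  have hp0 : (0 : ℝ) < p := by exact_mod_cast hp.pos
  have hr0 : 0 < r := by rw [hr]; exact zpow_pos hp0 _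
  have hr1 : r < 1 := by
    rw [hr]
    exact zpow_lt_one_of_neg₀ (by exact_mod_cast hp.one_lt)
      (neg_neg_iff_pos.mpr (by exact_mod_cast Nat.pos_of_ne_zero (cyclotomicExponent_ne_zero p)))
  set K : ℝ := ‖((Nat.factorial k : ℕ) : ℚ_[p])⁻¹‖ * (max ‖(logCyclotomicGenerator p)⁻¹‖ 1) ^ k *
    (‖β⁻¹‖ ^ cyclotomicExponent p * C) with hK
  -- comparison series `K (j+1)^k r^j = (K/r) (j+1)^k r^{j+1}`
  have hg : Summable fun j : ℕ => K * r⁻¹ * (((j + 1 : ℕ) : ℝ) ^ k * r ^ (j + 1)) := by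
    have h := (summable_nat_add_iff 1).mpr
      (summable_pow_mul_geometric_of_norm_lt_one k (r := r) (by rwa [Real.norm_of_nonneg hr0.le]))
    exact (h.mul_left (K * r⁻¹))
  refine Summable.of_norm_bounded hg fun j => ?_
  rw [norm_mul]
  calc ‖mahlerLogCoeff p k j‖ * ‖teichmullerShiftedMoment Φ.toFun β ξ j‖
      ≤ (‖((Nat.factorial k : ℕ) : ℚ_[p])⁻¹‖ *
          ((max ‖(logCyclotomicGenerator p)⁻¹‖ 1) ^ k * ((j + 1 : ℕ) : ℝ) ^ k)) *
        (‖β⁻¹‖ ^ cyclotomicExponent p * (r ^ j * C)) :=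
        mul_le_mul (norm_mahlerLogCoeff_le p k j)
          (norm_teichmullerShiftedMoment_le Φ.toFun β ξ hC0 hC j) (norm_nonneg _)
          ((norm_nonneg _).trans (norm_mahlerLogCoeff_le p k j))
    _ = K * r⁻¹ * (((j + 1 : ℕ) : ℝ) ^ k * r ^ (j + 1)) := by
        rw [hK, pow_succ]
        field_simp

/-- **`log_p(γ)` is the genuine sum of its series**: the terms `(−1)^{j+1} p^{e₀ j}/j` are
`O((j+1) p^{−e₀ j})`. [cite: PollackStevens2011, §9.1 (p. 41), "log_γ(z) = log_p(z)/log_p(γ)"] -/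
theorem summable_logCyclotomicGenerator :
    Summable fun j : ℕ => coeff j (logOnePlusSeries p) * (p : ℚ_[p]) ^ (cyclotomicExponent p * j) := by
  have hp : p.Prime := Fact.out
  set r : ℝ := (p : ℝ) ^ (-(cyclotomicExponent p : ℤ)) with hr
  have hp0 : (0 : ℝ) < p := by exact_mod_cast hp.pos
  have hr0 : 0 < r := by rw [hr]; exact zpow_pos hp0 _
  have hr1 : r < 1 := by
    rw [hr]
    exact zpow_lt_one_of_neg₀ (by exact_mod_cast hp.one_lt)
      (neg_neg_iff_pos.mpr (by exact_mod_cast Nat.pos_of_ne_zero (cyclotomicExponent_ne_zero p)))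
  have hnorm : ∀ j : ℕ, ‖(p : ℚ_[p]) ^ (cyclotomicExponent p * j)‖ = r ^ j := by
    intro j
    rw [pow_mul, norm_pow, Padic.norm_p_pow, hr]
  have hg : Summable fun j : ℕ => r⁻¹ * (((j + 1 : ℕ) : ℝ) ^ 1 * r ^ (j + 1)) := by
    have h := (summable_nat_add_iff 1).mpr
      (summable_pow_mul_geometric_of_norm_lt_one 1 (r := r) (by rwa [Real.norm_of_nonneg hr0.le]))
    exact h.mul_left r⁻¹
  refine Summable.of_norm_bounded hg fun j => ?_
  rw [norm_mul, hnorm, pow_one]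
  calc ‖coeff j (logOnePlusSeries p)‖ * r ^ j ≤ ((j + 1 : ℕ) : ℝ) * r ^ j :=
        mul_le_mul_of_nonneg_right (norm_coeff_logOnePlusSeries_le p j) (pow_nonneg hr0.le _)
    _ = r⁻¹ * (((j + 1 : ℕ) : ℝ) * r ^ (j + 1)) := by
        rw [pow_succ]
        field_simp

/-- `log_p(γ) = ∑_{j ≥ 1} (−1)^{j+1} p^{e₀ j}/j` as a convergent sum. [cite: PollackStevens2011, §9.1 (p. 41)] -/
theorem hasSum_logCyclotomicGenerator :
    HasSum (fun j : ℕ => coeff j (logOnePlusSeries p) * (p : ℚ_[p]) ^ (cyclotomicExponent p * j))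
      (logCyclotomicGenerator p) :=
  (summable_logCyclotomicGenerator (p := p)).hasSum

/-- Hence each coefficient `c_k(Φ, β)` is the genuine sum of its defining series (a finite sum over
`μ_τ` of convergent series), not a junk value. [cite: PollackStevens2011, §9.1–9.2 (pp. 41–42)] -/
theorem hasSum_criticalSlopePAdicLCoeff {M : ℕ} (Φ : OMSymb p M) (β : ℚ_[p]) (k : ℕ) :
    HasSum (fun j => ∑ᶠ ξ : rootsOfUnity (torsionOrder p) ℤ_[p],
        mahlerLogCoeff p k j * teichmullerShiftedMoment Φ.toFun β ξ j)
      (criticalSlopePAdicLCoeff Φ.toFun β k) := by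
  classical
  haveI := neZero_torsionOrder p
  haveI := Fintype.ofFinite (rootsOfUnity (torsionOrder p) ℤ_[p])
  unfold criticalSlopePAdicLCoeff
  simp_rw [finsum_eq_sum_of_fintype]
  exact hasSum_sum fun ξ _ =>
    (summable_mahlerLogCoeff_mul_teichmullerShiftedMoment Φ β ξ k).hasSum

end Literature.NumberTheory.EllipticCurves.OMSWeightTwo

end
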